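import Mathlib
import Literature.Probability.LatticeModels.GKSInequalities
import Literature.Probability.LatticeModels.IsingFKG
import Summits.CriticalPhenomena.Ising3DConformalLimit.Theorems.PrecisionLaplacianInverseMFerromagnetCondCovNonneg
import Summits.CriticalPhenomena.Ising3DConformalLimit.Theorems.PrecisionLaplacianInverseMFerromagnetLevelTwo
import HarnessLib

/-!
# Crux `PrecisionLaplacian.InverseMFerromagnet` (stmt-CriticalPhenomena-4798), line `Sketch` —
# stub `helper_marginal_four_mtp2` (G2: the four-site marginal of a pair ferromagnet is positive,
# even and satisfies the FKG lattice condition)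

THEOREM-ONLY file (no definitions).  Zero-field pair ferromagnet on `Fin n`
(`w = gksWeight univ K C`, `K ≥ 0`, `|C i| = 2`) and an embedding `e : Fin 4 ↪ Fin n` of four
visible sites.  The marginal weight `ν(s) = ∑_{ω : ω ∘ e = s} w(ω)` on `SpinConfig (Fin 4)` satisfies:
* `ν > 0`: the fibre `{ω : ω ∘ e = s}` contains `Function.extend e s 1` and `w > 0`;
* `ν(−s) = ν(s)`: reindex the fibre sum by the global flip `ω ↦ −ω` (a bijection of the fibre of
  `s` onto the fibre of `−s`) and use the flip invariance `w(−ω) = w(ω)` of a pair system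
  (`l2_gksWeight_neg`);
* the FKG lattice condition `ν(s)ν(s') ≤ ν(s ⊓ s')ν(s ⊔ s')`: Mathlib's Ahlswede–Daykin four
  functions theorem `four_functions_theorem_univ` on the finite distributive lattice
  `SpinConfig (Fin n) = (Fin n → ℤˣ)` (product order, `−1 < 1`) with
  `f₁ = w·1_{fibre s}`, `f₂ = w·1_{fibre s'}`, `f₃ = w·1_{fibre (s ⊓ s')}`, `f₄ = w·1_{fibre (s ⊔ s')}`;
  its pointwise hypothesis is the lattice condition of `w` (`gksWeight_pair_lattice`, from the
  supermodularity of `σ_uσ_v` on `{±1}²`) together with `(ω ⊓ ω') ∘ e = (ω ∘ e) ⊓ (ω' ∘ e)` and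
  dually (Karlin–Rinott: MTP₂ is preserved under marginalisation).
-/

namespace Summit.CriticalPhenomena.Ising3DConformalLimit.Cruxes.InverseMFerromagnet.PartialCovarianceLadder

open Literature.Probability.LatticeModels Finset Matrix

noncomputable section

/-- Every fibre `{ω : ω ∘ e = s}` of the restriction to the visible sites is nonempty. [folklore] -/
theorem mfm_fibre_nonempty {n : ℕ} (e : Fin 4 ↪ Fin n) (s : SpinConfig (Fin 4)) :
    ∃ ω : SpinConfig (Fin n), ∀ k, ω (e k) = s k :=
  ⟨Function.extend e s (fun _ => 1), fun k => e.injective.extend_apply _ _ k⟩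

/-- The fibre-restricted weight `1_{fibre}(ω) · w(ω)` is nonnegative. [folklore] -/
theorem mfm_ite_nonneg {n m : ℕ} (K : Fin m → ℝ) (C : Fin m → Finset (Fin n)) (p : Prop)
    [Decidable p] (ω : SpinConfig (Fin n)) :
    0 ≤ (if p then gksWeight Finset.univ K C ω else 0) := by
  split_ifs
  · exact (gksWeight_pos _ K C ω).le
  · exact le_rfl

/-- Restriction to the visible sites commutes with `⊓`. [folklore] -/
theorem mfm_fibre_inf {n : ℕ} (e : Fin 4 ↪ Fin n) {s s' : SpinConfig (Fin 4)}
    {a b : SpinConfig (Fin n)} (ha : ∀ k, a (e k) = s k) (hb : ∀ k, b (e k) = s' k) :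
    ∀ k, (a ⊓ b) (e k) = (s ⊓ s') k := fun k => by
  rw [Pi.inf_apply, Pi.inf_apply, ha k, hb k]

/-- Restriction to the visible sites commutes with `⊔`. [folklore] -/
theorem mfm_fibre_sup {n : ℕ} (e : Fin 4 ↪ Fin n) {s s' : SpinConfig (Fin 4)}
    {a b : SpinConfig (Fin n)} (ha : ∀ k, a (e k) = s k) (hb : ∀ k, b (e k) = s' k) :
    ∀ k, (a ⊔ b) (e k) = (s ⊔ s') k := fun k => by
  rw [Pi.sup_apply, Pi.sup_apply, ha k, hb k]

/-- **The pointwise Ahlswede–Daykin hypothesis** for the four fibre-restricted weights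
`fᵢ = w · 1_{fibre tᵢ}`, `(t₁, t₂, t₃, t₄) = (s, s', s ⊓ s', s ⊔ s')`:
`f₁(a) f₂(b) ≤ f₃(a ⊓ b) f₄(a ⊔ b)` (lattice condition of `w` on the fibres, `0 ≤ ·` off them). [folklore] -/
theorem mfm_four_hyp {n m : ℕ} (K : Fin m → ℝ) (C : Fin m → Finset (Fin n))
    (hK : ∀ i, 0 ≤ K i) (hC : ∀ i, (C i).card = 2) (e : Fin 4 ↪ Fin n)
    (s s' : SpinConfig (Fin 4)) (a b : SpinConfig (Fin n)) :
    (if (∀ k, a (e k) = s k) then gksWeight Finset.univ K C a else 0) *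
        (if (∀ k, b (e k) = s' k) then gksWeight Finset.univ K C b else 0) ≤
      (if (∀ k, (a ⊓ b) (e k) = (s ⊓ s') k) then gksWeight Finset.univ K C (a ⊓ b) else 0) *
        (if (∀ k, (a ⊔ b) (e k) = (s ⊔ s') k) then gksWeight Finset.univ K C (a ⊔ b) else 0) := by
  by_cases ha : ∀ k, a (e k) = s k
  · by_cases hb : ∀ k, b (e k) = s' k
    · rw [if_pos ha, if_pos hb, if_pos (mfm_fibre_inf e ha hb), if_pos (mfm_fibre_sup e ha hb)]
      exact gksWeight_pair_lattice K C hK hC a b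
    · rw [if_neg hb, mul_zero]
      exact mul_nonneg (mfm_ite_nonneg K C _ _) (mfm_ite_nonneg K C _ _)
  · rw [if_neg ha, zero_mul]
    exact mul_nonneg (mfm_ite_nonneg K C _ _) (mfm_ite_nonneg K C _ _)

/-- **G2 · `helper_marginal_four_mtp2` — the four-site marginal of a pair ferromagnet is positive, even and
satisfies the FKG lattice condition.**  For `K ≥ 0`, `|C i| = 2` and an embedding `e : Fin 4 ↪ Fin n`, the marginal
weight `ν(s) = ∑_{ω : ω ∘ e = s} gksWeight univ K C ω` on `SpinConfig (Fin 4)` has `ν > 0`, `ν(−s) = ν(s)` and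
`ν(s)ν(s') ≤ ν(s ⊓ s')ν(s ⊔ s')`.  Proof: `gksWeight` is log-supermodular on the product lattice
`SpinConfig (Fin n)` (`gksWeight_pair_lattice`, from `spin_mul_supermodular` of `IsingFKG`), and Mathlib's
`four_functions_theorem_univ` (Ahlswede–Daykin) with `f₁ = w·1_{·∘e = s}`, `f₂ = w·1_{·∘e = s'}`,
`f₃ = w·1_{·∘e = s⊓s'}`, `f₄ = w·1_{·∘e = s⊔s'}` gives the marginal lattice condition (Karlin–Rinott: MTP₂ is
closed under marginals); positivity from a point of the fibre, evenness by the flip `ω ↦ −ω`. [folklore] -/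
theorem helper_marginal_four_mtp2 :
    ∀ (n m : ℕ) (K : Fin m → ℝ) (C : Fin m → Finset (Fin n)), (∀ i, 0 ≤ K i) → (∀ i, (C i).card = 2) →
      ∀ (e : Fin 4 ↪ Fin n) (ν : SpinConfig (Fin 4) → ℝ),
        (∀ s, ν s = ∑ ω : SpinConfig (Fin n), if (∀ k, ω (e k) = s k) then gksWeight Finset.univ K C ω else 0) →
        (∀ s, 0 < ν s) ∧ (∀ s, ν (-s) = ν s) ∧ (∀ s s', ν s * ν s' ≤ ν (s ⊓ s') * ν (s ⊔ s')) := by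
  intro n m K C hK hC e ν hν
  refine ⟨fun s => ?_, fun s => ?_, fun s s' => ?_⟩
  · -- positivity: a point of the fibre carries positive weight
    rw [hν s]
    obtain ⟨ω₀, hω₀⟩ := mfm_fibre_nonempty e s
    calc (0 : ℝ) < gksWeight Finset.univ K C ω₀ := gksWeight_pos _ K C ω₀
      _ = (if (∀ k, ω₀ (e k) = s k) then gksWeight Finset.univ K C ω₀ else 0) := (if_pos hω₀).symm
      _ ≤ ∑ ω : SpinConfig (Fin n), (if (∀ k, ω (e k) = s k) then gksWeight Finset.univ K C ω else 0) :=
          Finset.single_le_sum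
            (f := fun ω : SpinConfig (Fin n) =>
              if (∀ k, ω (e k) = s k) then gksWeight Finset.univ K C ω else 0)
            (fun ω _ => mfm_ite_nonneg K C _ ω) (Finset.mem_univ ω₀)
  · -- evenness: reindex by the global flip
    rw [hν (-s), hν s]
    refine Fintype.sum_equiv (Equiv.neg (SpinConfig (Fin n))) _ _ fun ω => ?_
    have hiff : (∀ k, ω (e k) = (-s) k) ↔ ∀ k, (Equiv.neg (SpinConfig (Fin n)) ω) (e k) = s k := by
      simp only [Equiv.neg_apply, Pi.neg_apply, neg_eq_iff_eq_neg]
    rw [Equiv.neg_apply, l2_gksWeight_neg K C hC ω]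
    refine if_congr ?_ rfl rfl
    simpa only [Equiv.neg_apply] using hiff
  · -- FKG lattice condition: the four functions theorem on `SpinConfig (Fin n)`
    rw [hν s, hν s', hν (s ⊓ s'), hν (s ⊔ s')]
    exact four_functions_theorem_univ
      (fun ω : SpinConfig (Fin n) => if (∀ k, ω (e k) = s k) then gksWeight Finset.univ K C ω else 0)
      (fun ω : SpinConfig (Fin n) => if (∀ k, ω (e k) = s' k) then gksWeight Finset.univ K C ω else 0)
      (fun ω : SpinConfig (Fin n) =>
        if (∀ k, ω (e k) = (s ⊓ s') k) then gksWeight Finset.univ K C ω else 0)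
      (fun ω : SpinConfig (Fin n) =>
        if (∀ k, ω (e k) = (s ⊔ s') k) then gksWeight Finset.univ K C ω else 0)
      (fun ω => mfm_ite_nonneg K C _ ω) (fun ω => mfm_ite_nonneg K C _ ω)
      (fun ω => mfm_ite_nonneg K C _ ω) (fun ω => mfm_ite_nonneg K C _ ω)
      (fun a b => mfm_four_hyp K C hK hC e s s' a b)

end

end Summit.CriticalPhenomena.Ising3DConformalLimit.Cruxes.InverseMFerromagnet.PartialCovarianceLadder
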